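import Literature.Probability.LatticeModels.FKIsingQuadrilateralCrossingProofs
import HarnessLib

/-!
# Chelkak–Smirnov's crossing theorem: the combination `F^δ` of the two four-point observables

Sibling of `FKIsingQuadrilateralCrossingProofs.lean` (proved bricks of D. Chelkak, S. Smirnov,
Invent. Math. 189 (2012), Thm. 6.1); theorems only. In the proof (arXiv:0910.2045, p. 26) the two
s-holomorphic observables `F_[cd]`, `F_[ad]` of the discrete quadrilateral have, in units of
`(2δ)^{-1/2}` and up to the boundary phases `(τ(ζ))^{-1/2}`, the corner moduli
`F_[cd] : (a, b, c, d) ↦ (1, 1, Q/(√2P+Q), Q/(√2P+Q))`,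
`F_[ad] : (a, b, c, d) ↦ (P/(P+√2Q), 1, 1, P/(P+√2Q))`, the phases of the two observables at `d`
being OPPOSITE (eq. (6.4), "(xWind)"); the combination
`F^δ = [P(√2P+Q) F_[cd] + Q(P+√2Q) F_[ad]] / [P(√2P+Q) + Q(P+√2Q)]` then has corner moduli
`(A^δ, 1, C^δ, 0)` (eq. (6.5)) with the `A^δ, C^δ` of the display after (6.5) (`csA`, `csC` of the
proofs file). This file checks that algebra (`P = P^δ`, `Q = Q^δ = 1 - P^δ`, or any `P, Q ≥ 0` not
both zero):

* `cs_combination_d` — at `d` the combination vanishes: `P(√2P+Q) · Q/(√2P+Q) = Q(P+√2Q) · P/(P+√2Q)`;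
* `cs_combination_a` — at `a` it gives `A^δ`; `cs_combination_c` — at `c` it gives `C^δ`;
  `cs_combination_b` — at `b` it gives `1`.

## References
* [ChelkakSmirnov2012Ising] D. Chelkak, S. Smirnov, Invent. Math. 189 (2012), §6, proof of Thm. 6.1,
  the displays between (6.3) and (6.6) (arXiv:0910.2045 p. 26; READ).
-/

noncomputable section

namespace Literature.Probability.LatticeModels

variable {P Q : ℝ}

/-- `√2 P + Q > 0` for `P, Q ≥ 0` not both zero. [folklore] -/
theorem cs_sqrt_two_mul_add_pos (hP : 0 ≤ P) (hQ : 0 ≤ Q) (h : P ≠ 0 ∨ Q ≠ 0) :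
    0 < Real.sqrt 2 * P + Q := by
  have h2 : 0 < Real.sqrt 2 := Real.sqrt_pos.2 two_pos
  rcases h with h | h
  · exact add_pos_of_pos_of_nonneg (mul_pos h2 (lt_of_le_of_ne hP (Ne.symm h))) hQ
  · exact add_pos_of_nonneg_of_pos (mul_nonneg h2.le hP) (lt_of_le_of_ne hQ (Ne.symm h))

/-- `P + √2 Q > 0` for `P, Q ≥ 0` not both zero. [folklore] -/
theorem cs_add_sqrt_two_mul_pos (hP : 0 ≤ P) (hQ : 0 ≤ Q) (h : P ≠ 0 ∨ Q ≠ 0) :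
    0 < P + Real.sqrt 2 * Q := by
  have := cs_sqrt_two_mul_add_pos hQ hP (h.symm)
  linarith

/-- **`F^δ(d) = 0`**: with the opposite phases of `F_[cd]` and `F_[ad]` at `d` (eq. (6.4)), the
weights `P(√2P+Q)` and `Q(P+√2Q)` kill the corner `d`:
`P(√2P+Q) · Q/(√2P+Q) - Q(P+√2Q) · P/(P+√2Q) = 0`.
[cite: ChelkakSmirnov2012Ising, §6, proof of Thm. 6.1 (eq. (6.5), F^δ(d^δ) = 0)] -/
theorem cs_combination_d (hP : 0 ≤ P) (hQ : 0 ≤ Q) (h : P ≠ 0 ∨ Q ≠ 0) :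
    P * (Real.sqrt 2 * P + Q) * (Q / (Real.sqrt 2 * P + Q)) -
      Q * (P + Real.sqrt 2 * Q) * (P / (P + Real.sqrt 2 * Q)) = 0 := by
  have h1 := (cs_sqrt_two_mul_add_pos hP hQ h).ne'
  have h2 := (cs_add_sqrt_two_mul_pos hP hQ h).ne'
  rw [mul_div_assoc', mul_div_assoc', div_sub_div _ _ h1 h2, div_eq_zero_iff]
  left
  ring

/-- **`|F^δ(a)| = A^δ`** (in units of `(2δ)^{-1/2}`): at `a`, `F_[cd]` has modulus `1` and `F_[ad]`
modulus `P/(P+√2Q)` (same phase), and the normalised combination is `csA P Q`.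
[cite: ChelkakSmirnov2012Ising, §6, proof of Thm. 6.1 (eq. (6.5) and the display for A^δ)] -/
theorem cs_combination_a (hP : 0 ≤ P) (hQ : 0 ≤ Q) (h : P ≠ 0 ∨ Q ≠ 0) :
    (P * (Real.sqrt 2 * P + Q) * 1 + Q * (P + Real.sqrt 2 * Q) * (P / (P + Real.sqrt 2 * Q))) /
        (P * (Real.sqrt 2 * P + Q) + Q * (P + Real.sqrt 2 * Q)) = csA P Q := by
  have h2 := (cs_add_sqrt_two_mul_pos hP hQ h).ne'
  have e1 : Q * (P + Real.sqrt 2 * Q) * (P / (P + Real.sqrt 2 * Q)) = Q * P := by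
    rw [mul_assoc, ← mul_div_assoc, mul_div_cancel_left₀ _ h2]
  unfold csA
  rw [mul_one, e1]

/-- **`|F^δ(c)| = C^δ`**: at `c`, `F_[cd]` has modulus `Q/(√2P+Q)` and `F_[ad]` modulus `1` (same
phase), and the normalised combination is `csC P Q`.
[cite: ChelkakSmirnov2012Ising, §6, proof of Thm. 6.1 (eq. (6.5) and the display for C^δ)] -/
theorem cs_combination_c (hP : 0 ≤ P) (hQ : 0 ≤ Q) (h : P ≠ 0 ∨ Q ≠ 0) :
    (P * (Real.sqrt 2 * P + Q) * (Q / (Real.sqrt 2 * P + Q)) + Q * (P + Real.sqrt 2 * Q) * 1) /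
        (P * (Real.sqrt 2 * P + Q) + Q * (P + Real.sqrt 2 * Q)) = csC P Q := by
  have h1 := (cs_sqrt_two_mul_add_pos hP hQ h).ne'
  have e1 : P * (Real.sqrt 2 * P + Q) * (Q / (Real.sqrt 2 * P + Q)) = P * Q := by
    rw [mul_assoc, ← mul_div_assoc, mul_div_cancel_left₀ _ h1]
  unfold csC
  rw [mul_one, e1]

/-- **`F^δ(b) = (2δ)^{-1/2}`**: at `b` both observables have modulus `1`, so the normalised
combination is `1`. [cite: ChelkakSmirnov2012Ising, §6, proof of Thm. 6.1 (eq. (6.5))] -/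
theorem cs_combination_b (h : P ≠ 0 ∨ Q ≠ 0) :
    (P * (Real.sqrt 2 * P + Q) * 1 + Q * (P + Real.sqrt 2 * Q) * 1) /
        (P * (Real.sqrt 2 * P + Q) + Q * (P + Real.sqrt 2 * Q)) = 1 := by
  rw [mul_one, mul_one]
  exact div_self (csDen_pos h).ne'

end Literature.Probability.LatticeModels
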